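/-
Copyright (c) 2026 the pub-hodgecm-mathlib formalisation cell (harness21).  Prover seat hodgecm-mathlib-F0P2-p07 (g0), strike line L1
`stub_firstTermThetaPairing` (LEAD F0P6-plan (g14) OWNER WORD σ22 (D2)(c)): Track B «K2-LIT», hLiu418 = stmt-HodgeConjecture-24832, road `K2_Liu`,
socket #42S, organ S1 ROAD W: the middle-cell dilation row `hd₁`∕`hmid` of the ramified socket instance FROM A FACTORISATION ROW with an `Ad(d_a)`-invariant factor.
-/
import Summits.HodgeConjecture.HodgeConjecture.Theorems.K2LiuLocalSWSimilitudeAlgebra     -- ★ F5′-A1: `localCongr` = `Ad(d_a)`, `isSiegelDelta_localCongr_dA_iff`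
import HarnessLib

/-!
# Crux `HLiu418`, #42S organ S1, ROAD W: THE DILATION ROW `F(w₁·Ad_{d_a}x) = F(w₁·x)` FROM A MIDDLE-CELL FACTORISATION `F(w₁·x) = K·g(x)` WITH `g ∘ Ad(d_a) = g`

Cell `hodgecm-mathlib`, crux item hLiu418 = `stmt-HodgeConjecture-24832`; squad K2 ∕ K2Liu; LEAD F0P6-plan (g14), S1 assembler K2Liu-p08 (g5); prover F0P2-p07 (g0).
THEOREMS ONLY (no `def`, no instance, no notation, no named-fact hypothesis, no `sorry`); lane `--supports stmt-HodgeConjecture-24832 --as helper`.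

WHY.  The ramified socket instance ★ `K2LiuLocalSWSpanningRamified` ∕ ★∕📤 `K2LiuLocalSWSpanningRamifiedOfMiddleRow` is closed modulo ONE row: the middle-cell dilation
invariance `hd₁ : ∀ x ∈ P_Δ, F(w₁ · Ad_{d_a} x) = F(w₁ · x)` of the lattice-pair section (`Ad(d_a)` = ★ `localCongr`, `a` a `v`-unit).  The (ρ-mid) organ (★ (M1)
`K2LiuLocalSWTensorMiddleCellTransport`, (M2a) K2Liu-p26∕p01, ★ (M2b) `K2LiuMiddleProfileFactorisation.factorisation_of_middleProfile_balls`) delivers a FACTORISATION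
`hfac : ∀ x ∈ P_Δ, F(w₁·x) = K·g(x)` whose factor `g(x) = c(x)·μ(B_x)·μ(U_x)·μ(C_x)·𝟙[Q_x]` is built from the Levi part of `x` and VALUATION data of its corner `B(x) = t`
— all unchanged under `x ↦ Ad_{d_a}x` (`m·n(t) ↦ m·n(a⁻¹t)`, `|a| = 1`; ★ F7r-4).  This file is the shape-agnostic step: `hfac` + `hg : g ∘ Ad(d_a) = g on P_Δ` ⇒ `hd₁`
(`Ad(d_a)` preserves `P_Δ`, ★ `isSiegelDelta_localCongr_dA_iff`); the concrete `hg` for the (M2a) factor is the sequel edition once (M2a)'s bytes land.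
* `flip_mul_localCongr_dA_eq_of_factorisation` — generic quadratic `E∕F`, any `n`, any `w₁`, any scalar `K`, any factor `g`.
References: [Kudla1994] §3 Thm. 3.1; [KudlaSweet1997] §1; [HarrisKudlaSweet1996] §1 (1.11), (1.15); [BernsteinZelevinsky1976] §1.5.
HONEST LABEL.  Count-neutral helper: `HC_CM` is proved only modulo the 7 printed citations (2 remaining named inputs: hLiu418 = `stmt-HodgeConjecture-24832`,
h413 = `stmt-HodgeConjecture-24833`) until rung 0 closes.

## References
* [Kudla1994] S. S. Kudla, Israel J. Math. 87 (1994), §3 Thm. 3.1.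
* [KudlaSweet1997] S. S. Kudla, W. J. Sweet, Israel J. Math. 98 (1997), §1.
* [HarrisKudlaSweet1996] M. Harris, S. Kudla, W. J. Sweet, J. Amer. Math. Soc. 9 (1996), §1 (1.11), (1.15).
* [BernsteinZelevinsky1976] I. N. Bernstein, A. V. Zelevinsky, Russian Math. Surveys 31 (1976), §1.5.
-/

set_option autoImplicit false
set_option linter.dupNamespace false -- the mandated namespace repeats `HodgeConjecture.HodgeConjecture`

noncomputable section

open scoped Matrix
open NumberField IsDedekindDomain Matrix
open Literature.NumberTheory.Automorphic Literature.NumberTheory.Automorphic.UnitaryGroup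
open Literature.NumberTheory.GelbartRogawski1991.AdaptedBlocks
open Literature.NumberTheory.GelbartRogawski1991.UnitaryDualPair.LocalSplitting
open Summit.HodgeConjecture.HodgeConjecture.Cruxes.HLiu418.K2LiuLocalSWSimilitudeAlgebra

namespace Summit.HodgeConjecture.HodgeConjecture.Cruxes.HLiu418.K2LiuLocalSWRamifiedMiddleRowOfFactorisation

variable (F : Type) [Field F] [NumberField F] (E : Type) [Field E] [NumberField E] [Algebra F E] [Algebra.IsQuadraticExtension F E]
  (c : E ≃ₐ[F] E) {δ : E} (hcδ : c δ = -δ) (hδ : δ ≠ 0) {d : F} (hd : δ * δ = algebraMap F E d)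
  (v : HeightOneSpectrum (𝓞 F)) (n : ℕ) {T₀ : Matrix (Fin n) (Fin n) F} (hT₀ : T₀.IsSymm)
  {JD : Matrix (Fin (n + n)) (Fin (n + n)) E} (hJD : JD = (gramD F n T₀).map (algebraMap F E))
  (a : Fˣ) {D₀ : GL (Fin (n + n)) F}
  (hD₀ : (D₀ : Matrix (Fin (n + n)) (Fin (n + n)) F) =
    Matrix.reindex (e₂ n) (e₂ n) (cayR F (Fin n) * Matrix.fromBlocks 1 0 0 ((a : F) • (1 : Matrix (Fin n) (Fin n) F)) * cayRinv F (Fin n)))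
  {DA : GL (Fin (n + n)) E} (hDA : DA = Matrix.GeneralLinearGroup.map (algebraMap F E) D₀)
  {b : E} (hb : b ≠ 0) (hDAJ : formCongr (c : E →+* E) DA (b • JD) = JD)

include hD₀ hDA in
/-- **THE DILATION ROW FROM A FACTORISATION**: if `F(w₁·x) = K·g(x)` for every `x ∈ P_Δ` and `g(Ad_{d_a} x) = g(x)` on `P_Δ`, then `F(w₁·Ad_{d_a} x) = F(w₁·x)` on `P_Δ`
(`Ad(d_a) P_Δ = P_Δ`, ★ `isSiegelDelta_localCongr_dA_iff`) — the `hd₁` row of ★ `K2LiuLocalSWSpanningRamified.localDegPS_le_sup_localSWImage_of_ramified_witness` and the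
conclusion of the `hmid` binder of `K2LiuLocalSWSpanningRamifiedOfMiddleRow`. [cite: Kudla1994, §3 Thm. 3.1] [cite: KudlaSweet1997, §1] [cite: HarrisKudlaSweet1996, §1 (1.11)] -/
theorem flip_mul_localCongr_dA_eq_of_factorisation (F₀ : UnitaryGroup.localPi E c (n + n) JD v → ℂ) (w₁ : UnitaryGroup.localPi E c (n + n) JD v) (K : ℂ)
    (g : UnitaryGroup.localPi E c (n + n) JD v → ℂ)
    (hfac : ∀ x, IsSiegelDelta F E c hcδ hδ hd v n hT₀ hJD x → F₀ (w₁ * x) = K * g x)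
    (hg : ∀ x, IsSiegelDelta F E c hcδ hδ hd v n hT₀ hJD x → g (localCongr E c DA hb hDAJ v x) = g x) :
    ∀ x, IsSiegelDelta F E c hcδ hδ hd v n hT₀ hJD x → F₀ (w₁ * localCongr E c DA hb hDAJ v x) = F₀ (w₁ * x) := by
  intro x hx
  rw [hfac _ ((isSiegelDelta_localCongr_dA_iff F E c v n hJD a hD₀ hDA hb hDAJ hcδ hδ hd hT₀ x).2 hx), hfac x hx, hg x hx]

end Summit.HodgeConjecture.HodgeConjecture.Cruxes.HLiu418.K2LiuLocalSWRamifiedMiddleRowOfFactorisation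

end
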